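import Summits.QuantumFields.GaugeBoot.WordUpdate
import Summits.QuantumFields.GaugeBoot.DiagonalRPTorusTubeTerms
import HarnessLib

/-!
# Word-list Haar integrals: gluing, lonely links, reductions (gauge-boot, L3 `d = 3` uniform window, J2 brick 1)

HONEST FRAMING (cell `pub-gaugeboot`, page 1 of every file): the venture produces certified bounds
on lattice expectations at stated coupling, gauge group, dimension and torus size; NOT a mass gap,
NOT a continuum limit, NOT a string tension; NOT Yang–Mills-summit-bearing (barriers
`FixedCouplingUltralocality`, `PerturbativeInvisibility`). This module is bookkeeping for a
structural NEGATIVE result (a coupling window UNIFORM in the torus size for the failure of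
inner-half diagonal reflection positivity on `(ℤ/L)^3`, plan note
`HOME/pub-gaugeboot-lean3/gen46/D3-UNIFORM-PLAN.md` §3 item 6c (J2)); it discharges nothing by
itself.

## Content (torus `(ℤ/L)^d`, compact metrisable `G`, continuous `ρ`)

The strong-coupling evaluation of a product-Haar integral of real characters of LOOP holonomies,
`wlInt ρ ws = ∫ ∏_{(x,w) ∈ ws} Re χ(hol_x(w)(U)) dU` for a list of based lattice words
(`LatticeWords`, `WordUpdate`), by the folklore rules (Creutz, *Quarks, gluons and lattices*, Ch. 8–9):

* `wlInt_nil = 1`, `wlInt_perm` (order irrelevant), `wlInt_cons_congr` (replace a word by one with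
  the same `Re χ ∘ hol`: `reTr_wordHolonomy_backtrack`, `reTr_wordHolonomy_rotate`),
  `wlInt_cons_nil_word` (an empty word contributes the factor `Re χ(1) = N`);
* ★ **`wlInt_lonely`** — a link read exactly once, by one word, kills the integral (centre twist
  `ρ z₀ = ω • 1`, `ω ≠ 1`: `DiagRPTube.integral_reTr_mul_eq_zero`);
* ★★ **`wlInt_glue`** — THE GLUING RULE: if the link `e` is read exactly once BACKWARD by the
  closed word `w₁` (split `w₁ = A₁ ē B₁`), exactly once FORWARD by the closed word `w₂`
  (`w₂ = A₂ e B₂`) and by no other word, then under the character identity (R1)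
  `∫ Re χ(x g⁻¹) Re χ(g y) dg = c₁ Re χ(x y)`,
  `wlInt ((x₁,w₁) :: (x₂,w₂) :: ws) = c₁ · wlInt ((x₁, A₁ B₂ A₂ B₁) :: ws)`:
  the two plaquettes/loops are glued along `e` into one loop (`Word.Split` of `WordUpdate`,
  one-link resampling `DiagRPSUN.integral_pi_update_of_forall`).

A kernel-checkable script language over these rules (local words in the `ℤ³` chart) is brick 2.
Elementary; no named fact.
-/

open MeasureTheory Finset Function

namespace Summit.QuantumFields.GaugeBoot

open Literature.MathematicalPhysics.QuantumFieldTheory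
open Literature.MathematicalPhysics.QuantumFieldTheory.PlaquetteLowerBound (reTr continuous_reTr)

noncomputable section

namespace DiagRPHex

variable {d L : ℕ} [NeZero L] {N : ℕ} {G : Type*} [Group G] [TopologicalSpace G]
  [IsTopologicalGroup G] [CompactSpace G] [MeasurableSpace G] [BorelSpace G]
  (ρ : G →* Matrix (Fin N) (Fin N) ℂ)

/-! ## The word-list integral -/

/-- The product of the real characters of the holonomies of a list of based words. -/
def wlProd (ws : List (Site d L × Word d)) (U : GaugeConfig d L G) : ℝ :=
  (ws.map fun xw => reTr ρ (wordHolonomy U xw.1 xw.2)).prod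

/-- THE WORD-LIST INTEGRAL `∫ ∏ Re χ(hol_x(w)) dU` (product Haar measure). -/
def wlInt (ws : List (Site d L × Word d)) : ℝ :=
  ∫ U, wlProd ρ ws U ∂Measure.pi (fun _ : Edge d L => haarProbability G)

omit [NeZero L] [CompactSpace G] [MeasurableSpace G] [BorelSpace G] in
/-- The word-list product is continuous (`ρ` continuous). -/
theorem continuous_wlProd (hρ : Continuous ρ) : ∀ ws : List (Site d L × Word d),
    Continuous (wlProd (G := G) ρ ws)
  | [] => by
    unfold wlProd
    simpa using continuous_const
  | xw :: ws => by
    -- continuity of word holonomies (as in `WordDerivative`, for a general universe)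
    have hw : ∀ (w : Word d) (x : Site d L), Continuous fun U : GaugeConfig d L G => wordHolonomy U x w := by
      intro w
      induction w with
      | nil => intro x; simpa using continuous_const
      | cons s w ih =>
        intro x
        simp only [wordHolonomy_cons]
        refine Continuous.mul ?_ (ih (s.apply x))
        cases s with
        | fwd μ => exact continuous_apply _
        | bwd μ => exact (continuous_apply _).inv
    have h : wlProd (G := G) ρ (xw :: ws) = fun U =>
        reTr ρ (wordHolonomy U xw.1 xw.2) * wlProd ρ ws U := by
      funext U; simp [wlProd]
    rw [h]
    exact ((continuous_reTr ρ hρ).comp (hw xw.2 xw.1)).mul (continuous_wlProd hρ ws)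

omit [NeZero L] [MeasurableSpace G] [BorelSpace G] [TopologicalSpace G] [IsTopologicalGroup G]
  [CompactSpace G] in
/-- Unfolding the product at the head. -/
theorem wlProd_cons (xw : Site d L × Word d) (ws : List (Site d L × Word d)) (U : GaugeConfig d L G) :
    wlProd ρ (xw :: ws) U = reTr ρ (wordHolonomy U xw.1 xw.2) * wlProd ρ ws U := by
  simp [wlProd]

/-! ## Structural rules -/

/-- The empty list integrates to `1`. -/
theorem wlInt_nil : wlInt (d := d) (L := L) (G := G) ρ [] = 1 := by
  simp [wlInt, wlProd]

/-- The order of the words is irrelevant. -/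
theorem wlInt_perm {ws ws' : List (Site d L × Word d)} (h : ws.Perm ws') :
    wlInt (G := G) ρ ws = wlInt ρ ws' := by
  unfold wlInt wlProd
  congr 1
  funext U
  exact (h.map _).prod_eq

/-- Replacing the head word by one with the same character of holonomy. -/
theorem wlInt_cons_congr {x x' : Site d L} {w w' : Word d}
    (h : ∀ U : GaugeConfig d L G, reTr ρ (wordHolonomy U x w) = reTr ρ (wordHolonomy U x' w'))
    (ws : List (Site d L × Word d)) :
    wlInt (G := G) ρ ((x, w) :: ws) = wlInt ρ ((x', w') :: ws) := by
  unfold wlInt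
  congr 1
  funext U
  rw [wlProd_cons, wlProd_cons, h U]

omit [NeZero L] [MeasurableSpace G] [BorelSpace G] [TopologicalSpace G] [IsTopologicalGroup G]
  [CompactSpace G] in
/-- `Re χ(1) = N`. -/
theorem reTr_one : reTr ρ (1 : G) = N := by
  simp [reTr]

/-- An empty word contributes the factor `N`. -/
theorem wlInt_cons_nil_word (x : Site d L) (ws : List (Site d L × Word d)) :
    wlInt (G := G) ρ ((x, ([] : Word d)) :: ws) = N * wlInt ρ ws := by
  unfold wlInt
  rw [← integral_const_mul]
  congr 1
  funext U
  rw [wlProd_cons, wordHolonomy_nil, reTr_one]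

omit [NeZero L] [MeasurableSpace G] [BorelSpace G] [TopologicalSpace G] [IsTopologicalGroup G]
  [CompactSpace G] in
/-- **Backtracks cancel** inside a word. -/
theorem reTr_wordHolonomy_backtrack (U : GaugeConfig d L G) (x : Site d L) (v w : Word d) (s : Step d) :
    reTr ρ (wordHolonomy U x (v ++ [s, s.inv] ++ w)) = reTr ρ (wordHolonomy U x (v ++ w)) := by
  rw [wordHolonomy_backtrack]

omit [NeZero L] [MeasurableSpace G] [BorelSpace G] [TopologicalSpace G] [IsTopologicalGroup G]
  [CompactSpace G] in
/-- **Rotating a closed word** does not change the character of its holonomy. -/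
theorem reTr_wordHolonomy_rotate (U : GaugeConfig d L G) {x : Site d L} (s : Step d) {w : Word d}
    (hclosed : Word.endpoint x (s :: w) = x) :
    reTr ρ (wordHolonomy U x (s :: w)) = reTr ρ (wordHolonomy U (s.apply x) (w ++ [s])) := by
  rw [Word.endpoint_cons] at hclosed
  rw [wordHolonomy_cons, wordHolonomy_append, hclosed, DiagRPSUN.reTr_mul_comm]
  simp

/-! ## Lonely links -/

section Rules

variable [SecondCountableTopology G]

/-- ★ **A link read exactly once kills the integral** (centre twist). -/
theorem wlInt_lonely (hρ : Continuous ρ) {z₀ : G} {ω : ℂ}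
    (hz₀ : ρ z₀ = ω • (1 : Matrix (Fin N) (Fin N) ℂ)) (hω : ω ≠ 1)
    {x : Site d L} {w : Word d} {e : Edge d L} (S : Word.Split x w e)
    (ws : List (Site d L × Word d)) (hws : ∀ xw ∈ ws, e ∉ Word.edgesRead xw.1 xw.2) :
    wlInt (G := G) ρ ((x, w) :: ws) = 0 := by
  classical
  unfold wlInt
  rw [DiagRPSUN.integral_pi_update_of_forall (haarProbability G) e
    (DiagRPTube.integrable_of_continuous (continuous_wlProd ρ hρ _)) (H := fun _ => (0 : ℝ))]
  · simp
  intro U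
  have hrest : ∀ s : G, wlProd ρ ws (update U e s) = wlProd ρ ws U := fun s => by
    unfold wlProd
    congr 1
    refine List.map_congr_left fun xw hxw => ?_
    rw [wordHolonomy_update_of_not_mem U e s xw.1 xw.2 (hws xw hxw)]
  have hhead : ∀ s : G, reTr ρ (wordHolonomy (update U e s) x w) = reTr ρ (s * S.staple U) :=
    fun s => S.re_trace_wordHolonomy_update ρ hρ U s
  simp_rw [wlProd_cons, hrest, hhead]
  rw [integral_mul_const, DiagRPTube.integral_reTr_mul_eq_zero ρ hρ hz₀ hω, zero_mul]

/-! ## Gluing -/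

omit [NeZero L] [SecondCountableTopology G] [MeasurableSpace G] [BorelSpace G] [TopologicalSpace G]
  [IsTopologicalGroup G] [CompactSpace G] in
/-- The reading step of a split reads `e` from the endpoint of the prefix: backward case. -/
theorem Split.endpoint_pre_of_bwd {x : Site d L} {w : Word d} {e : Edge d L} (S : Word.Split x w e)
    (h : S.step.isFwd = false) : Word.endpoint x S.pre = e.1.shift e.2 ∧ S.step = Step.bwd e.2 := by
  have hst := S.step_edge
  cases hs : S.step with
  | fwd μ => rw [hs] at h; simp at h
  | bwd μ =>
    rw [hs] at hst
    simp only [Step.edge_bwd] at hst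
    have h2 : μ = e.2 := by rw [← hst]
    subst h2
    refine ⟨?_, rfl⟩
    have h1 := congrArg Prod.fst hst
    simp only at h1
    rw [← h1]
    simp [Site.shift]

omit [NeZero L] [SecondCountableTopology G] [MeasurableSpace G] [BorelSpace G] [TopologicalSpace G]
  [IsTopologicalGroup G] [CompactSpace G] in
/-- The reading step of a split reads `e` from the endpoint of the prefix: forward case. -/
theorem Split.endpoint_pre_of_fwd {x : Site d L} {w : Word d} {e : Edge d L} (S : Word.Split x w e)
    (h : S.step.isFwd = true) : Word.endpoint x S.pre = e.1 ∧ S.step = Step.fwd e.2 := by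
  have hst := S.step_edge
  cases hs : S.step with
  | bwd μ => rw [hs] at h; simp at h
  | fwd μ =>
    rw [hs] at hst
    simp only [Step.edge_fwd] at hst
    have h2 : μ = e.2 := by rw [← hst]
    subst h2
    exact ⟨congrArg Prod.fst hst, rfl⟩

omit [NeZero L] [SecondCountableTopology G] in
/-- The one-variable character identity behind the gluing rule:
`∫ Re χ(g s₁) Re χ(g s₂) dg = c₁ Re χ(s₁⁻¹ s₂)` under (R1). -/
theorem integral_reTr_mul_reTr_mul (hρ : Continuous ρ) {c₁ : ℝ}
    (hR1 : ∀ x y : G, ∫ g, reTr ρ (x * g⁻¹) * reTr ρ (g * y) ∂haarProbability G = c₁ * reTr ρ (x * y))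
    (s₁ s₂ : G) :
    ∫ g, reTr ρ (g * s₁) * reTr ρ (g * s₂) ∂haarProbability G = c₁ * reTr ρ (s₁⁻¹ * s₂) := by
  have h := hR1 s₁⁻¹ s₂
  have h1 : ∀ g : G, reTr ρ (s₁⁻¹ * g⁻¹) = reTr ρ (g * s₁) := fun g => by
    rw [show s₁⁻¹ * g⁻¹ = (g * s₁)⁻¹ by group]
    exact Literature.RepresentationTheory.CompactGroups.CompactGroup.re_trace_map_inv ρ hρ _
  simp_rw [h1] at h
  exact h

/-- ★★ **THE GLUING RULE.** `e` read exactly once backward by `w₁` (split `S₁`), exactly once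
forward by the closed word `w₂` (split `S₂`), by no other word; (R1) with constant `c₁`. Then
`wlInt ((x₁,w₁) :: (x₂,w₂) :: ws) = c₁ · wlInt ((x₁, S₁.pre ++ S₂.suf ++ S₂.pre ++ S₁.suf) :: ws)`. -/
theorem wlInt_glue (hρ : Continuous ρ) {c₁ : ℝ}
    (hR1 : ∀ x y : G, ∫ g, reTr ρ (x * g⁻¹) * reTr ρ (g * y) ∂haarProbability G = c₁ * reTr ρ (x * y))
    {x₁ x₂ : Site d L} {w₁ w₂ : Word d} {e : Edge d L} (S₁ : Word.Split x₁ w₁ e)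
    (S₂ : Word.Split x₂ w₂ e) (h₁ : S₁.step.isFwd = false) (h₂ : S₂.step.isFwd = true)
    (hclosed₂ : Word.endpoint x₂ w₂ = x₂) (ws : List (Site d L × Word d))
    (hws : ∀ xw ∈ ws, e ∉ Word.edgesRead xw.1 xw.2) :
    wlInt (G := G) ρ ((x₁, w₁) :: (x₂, w₂) :: ws) =
      c₁ * wlInt ρ ((x₁, S₁.pre ++ S₂.suf ++ S₂.pre ++ S₁.suf) :: ws) := by
  classical
  -- base points of the four pieces
  obtain ⟨hp₁, hs₁⟩ := Split.endpoint_pre_of_bwd S₁ h₁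
  obtain ⟨hp₂, hs₂⟩ := Split.endpoint_pre_of_fwd S₂ h₂
  have hstart₂ : Step.apply e.1 S₂.step = e.1.shift e.2 := by rw [hs₂]; rfl
  have hstart₁ : Step.apply (e.1.shift e.2) S₁.step = e.1 := by
    rw [hs₁]; simp [Step.apply, Site.shift]
  have hend₂ : Word.endpoint (e.1.shift e.2) S₂.suf = x₂ := by
    have := hclosed₂
    rw [S₂.eq, Word.endpoint_append, Word.endpoint_cons, hp₂, hstart₂] at this
    exact this
  -- the merged holonomy
  have hmerge : ∀ U : GaugeConfig d L G,
      wordHolonomy U x₁ (S₁.pre ++ S₂.suf ++ S₂.pre ++ S₁.suf) =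
        S₁.preHol U * S₂.sufHol U * S₂.preHol U * S₁.sufHol U := by
    intro U
    simp only [wordHolonomy_append, Word.endpoint_append, hp₁, hend₂, hp₂, Word.Split.preHol,
      Word.Split.sufHol, hstart₂, hstart₁]
  unfold wlInt
  rw [← integral_const_mul]
  refine DiagRPSUN.integral_pi_update_of_forall (haarProbability G) e
    (DiagRPTube.integrable_of_continuous (continuous_wlProd ρ hρ _)) fun U => ?_
  have hrest : ∀ s : G, wlProd ρ ws (update U e s) = wlProd ρ ws U := fun s => by
    unfold wlProd
    congr 1
    refine List.map_congr_left fun xw hxw => ?_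
    rw [wordHolonomy_update_of_not_mem U e s xw.1 xw.2 (hws xw hxw)]
  have hh₁ : ∀ s : G, reTr ρ (wordHolonomy (update U e s) x₁ w₁) = reTr ρ (s * S₁.staple U) :=
    fun s => S₁.re_trace_wordHolonomy_update ρ hρ U s
  have hh₂ : ∀ s : G, reTr ρ (wordHolonomy (update U e s) x₂ w₂) = reTr ρ (s * S₂.staple U) :=
    fun s => S₂.re_trace_wordHolonomy_update ρ hρ U s
  simp_rw [wlProd_cons, hrest, hh₁, hh₂]
  have hsplit : ∀ s : G, reTr ρ (s * S₁.staple U) * (reTr ρ (s * S₂.staple U) * wlProd ρ ws U) =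
      (reTr ρ (s * S₁.staple U) * reTr ρ (s * S₂.staple U)) * wlProd ρ ws U := fun s => by ring
  simp_rw [hsplit]
  rw [integral_mul_const, integral_reTr_mul_reTr_mul ρ hρ hR1]
  -- the merged word does not read `e`, so its holonomy is frozen too
  have hstaple : (S₁.staple U)⁻¹ * S₂.staple U =
      S₁.sufHol U * S₁.preHol U * (S₂.sufHol U * S₂.preHol U) := by
    simp only [Word.Split.staple, h₁, h₂, Bool.false_eq_true, ↓reduceIte, inv_inv]
  have key : reTr ρ (S₁.sufHol U * S₁.preHol U * (S₂.sufHol U * S₂.preHol U)) =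
      reTr ρ (S₁.preHol U * S₂.sufHol U * S₂.preHol U * S₁.sufHol U) := by
    rw [show S₁.sufHol U * S₁.preHol U * (S₂.sufHol U * S₂.preHol U) =
      S₁.sufHol U * (S₁.preHol U * S₂.sufHol U * S₂.preHol U) by group, DiagRPSUN.reTr_mul_comm]
  rw [hstaple, hmerge, key]
  ring

end Rules

end DiagRPHex

end

end Summit.QuantumFields.GaugeBoot
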